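import Summits.Ventures.Crystal3D.Bulk.HullFaceSubtended
import Literature.Geometry.DiscreteGeometry.ConvexHullFacets
import HarnessLib

/-!
# The fan triangles of the hull tile space: every vector lies in the cone of the fan triangle on
# the left of some hull dart, hence in the corner fan of some face of any covering sub-map
# (rattler prune (d1)(d2): "every rattler lies in SOME face", `DESIGN-L12-THEORY` §P-L3 (d))

HONEST FRAMING. Part of the venture `Summits/Ventures/Crystal3D` (cell `pub-crystal3d`, phase 2;
seat p3), generic and configuration-free (`X` any finite set of unit vectors of `ℝ³` with `0`
interior to its hull); nothing here mentions GAP(1.26). The Literature tiles space by the cones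
over the FACETS of `conv X` (`ConeTiling.exists_mem_argmaxCone`,
`ConvexHullFacets.argmaxCone_facetNormals_eq`: the argmax cone of a facet normal is the cone
over the facet) and triangulates each facet polygon by the fan from its first vertex
(`fanTriangles`, `fVert`; `SphericalPolygonFan` records only `fanCone ⊆ polyCone`). This file
supplies the converse inclusion and the bookkeeping:

* `exists_mem_cone_fan_of_combination` — a nonnegative combination of the vertices
  `w 0, …, w (m−1)` of a strictly convex polygonal cone (all increasing triples positively
  oriented) lies in the closed cone of some fan triangle `(w 0, w k, w (k+1))` (sign change of
  `k ↦ det[w 0; w k; x]` and the expansion `orient3_expand`);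
* **`exists_mem_dartCone`** — every `z : ℝ³` lies in `dartCone X x` for some hull dart `x`;
* `exists_corner_of_cover` — in a sub-map `S` covering every vertex, every hull dart lies in
  the corner of some dart of `S` (`σ_H^i w = x`, `i < retTime S w`);
* **`exists_inCornerFan_of_cover`** — hence every `z` lies in the corner fan of the face of
  some dart of `S` (`InCornerFan`, `Bulk/HullFaceSubtended.lean`).
-/

noncomputable section

namespace Summit.Ventures.Crystal3D

namespace HullRotSys

open Literature.Geometry.DiscreteGeometry Finset Equiv Real Function
open scoped InnerProductSpace

variable {X : Finset (EuclideanSpace ℝ (Fin 3))} {hX1 : ∀ y ∈ X, ‖y‖ = 1}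
  {h0 : (0 : EuclideanSpace ℝ (Fin 3)) ∈ interior (convexHull ℝ (X : Set _))}

/-! ## A convex polygonal cone is the union of its fan triangles -/

/-- **Fan covering.** If all increasingly indexed triples of `w 0, …, w (m−1)` (`m ≥ 3`) are
positively oriented, every nonnegative combination `x = Σ_{i<m} λ i • w i` lies in the closed
cone of a fan triangle `(w 0, w k, w (k+1))`, `1 ≤ k`, `k + 1 < m`. -/
theorem exists_mem_cone_fan_of_combination {m : ℕ} (hm : 3 ≤ m) (w : ℕ → EuclideanSpace ℝ (Fin 3))
    (hpos : ∀ i j k : ℕ, i < j → j < k → k < m → 0 < orient3 (w i) (w j) (w k))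
    (coef : ℕ → ℝ) (hcoef : ∀ i, 0 ≤ coef i) {x : EuclideanSpace ℝ (Fin 3)}
    (hx : x = ∑ i ∈ range m, coef i • w i) :
    ∃ k, 1 ≤ k ∧ k + 1 < m ∧ ∃ a b c : ℝ, 0 ≤ a ∧ 0 ≤ b ∧ 0 ≤ c ∧
      x = a • w 0 + b • w k + c • w (k + 1) := by
  -- `f k = det[w 0; w k; x] = Σ_i λ_i det[w 0; w k; w i]`
  set f : ℕ → ℝ := fun k => orient3 (w 0) (w k) x with hf
  have hfsum : ∀ k, f k = ∑ i ∈ range m, coef i * orient3 (w 0) (w k) (w i) := by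
    intro k
    show orient3 (w 0) (w k) x = _
    rw [← orient3Right_apply, hx, map_sum]
    refine Finset.sum_congr rfl fun i _ => ?_
    rw [map_smul, orient3Right_apply, smul_eq_mul]
  -- `f 1 ≥ 0`, `f (m-1) ≤ 0`
  have hf1 : 0 ≤ f 1 := by
    rw [hfsum]
    refine Finset.sum_nonneg fun i hi => mul_nonneg (hcoef i) ?_
    rw [mem_range] at hi
    rcases Nat.lt_or_ge i 2 with h2 | h2
    · rcases (show i = 0 ∨ i = 1 by omega) with rfl | rfl
      · rw [orient3_self_outer]
      · rw [orient3_self_right]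
    · exact (hpos 0 1 i (by omega) (by omega) hi).le
  have hflast : f (m - 1) ≤ 0 := by
    rw [hfsum]
    refine Finset.sum_nonpos fun i hi => ?_
    rw [mem_range] at hi
    rcases Nat.lt_or_ge i (m - 1) with h2 | h2
    · rcases Nat.eq_zero_or_pos i with rfl | hi0
      · rw [orient3_self_outer, mul_zero]
      · have := hpos 0 i (m - 1) hi0 h2 (by omega)
        rw [orient3_swap_right] at this
        exact mul_nonpos_iff.2 (Or.inl ⟨hcoef i, by linarith⟩)
    · rw [show i = m - 1 by omega, orient3_self_right, mul_zero]
  -- the last `k ∈ [1, m-2]` with `f k ≥ 0`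
  set k := Nat.findGreatest (fun k => 0 ≤ f k) (m - 2) with hk
  have hk1 : 1 ≤ k := Nat.le_findGreatest (by omega) hf1
  have hkm : k ≤ m - 2 := Nat.findGreatest_le _
  have hfk : 0 ≤ f k := Nat.findGreatest_spec (P := fun k => 0 ≤ f k) (by omega) hf1
  have hfk1 : f (k + 1) ≤ 0 := by
    rcases Nat.lt_or_ge (k + 1) (m - 1) with hlt | hge
    · have := Nat.findGreatest_is_greatest (P := fun k => 0 ≤ f k) (Nat.lt_succ_self k) (by omega)
      exact le_of_lt (not_le.1 this)
    · rw [show k + 1 = m - 1 by omega]; exact hflast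
  refine ⟨k, hk1, by omega, ?_⟩
  -- expand `x` in the basis `w 0, w k, w (k+1)`
  have hD := hpos 0 k (k + 1) (by omega) (Nat.lt_succ_self k) (by omega)
  have hexp := orient3_expand (w 0) (w k) (w (k + 1)) x
  -- the coefficient of `w 0`
  have hc0 : 0 ≤ orient3 x (w k) (w (k + 1)) := by
    rw [orient3_cyclic, ← orient3Right_apply, hx, map_sum]
    refine Finset.sum_nonneg fun i hi => ?_
    rw [map_smul, orient3Right_apply, smul_eq_mul]
    refine mul_nonneg (hcoef i) ?_
    rw [mem_range] at hi
    rcases lt_trichotomy i k with h1 | rfl | h1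
    · rw [← orient3_cyclic]; exact (hpos i k (k + 1) h1 (Nat.lt_succ_self k) (by omega)).le
    · rw [orient3_self_outer]
    · rcases (show i = k + 1 ∨ k + 1 < i by omega) with rfl | h2
      · rw [orient3_self_right]
      · exact (hpos k (k + 1) i (Nat.lt_succ_self k) h2 hi).le
  refine ⟨orient3 x (w k) (w (k + 1)) / orient3 (w 0) (w k) (w (k + 1)),
    orient3 (w 0) x (w (k + 1)) / orient3 (w 0) (w k) (w (k + 1)),
    orient3 (w 0) (w k) x / orient3 (w 0) (w k) (w (k + 1)),
    div_nonneg hc0 hD.le, div_nonneg ?_ hD.le, div_nonneg hfk hD.le, ?_⟩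
  · rw [orient3_swap_right]; linarith
  · simp only [div_eq_inv_mul, mul_smul, ← smul_add]
    rw [← hexp, smul_smul, inv_mul_cancel₀ hD.ne', one_smul]

/-! ## Every vector lies in the cone of the left triangle of some hull dart -/

/-- **The fan triangles tile space.** Every `z : ℝ³` lies in `dartCone X x` for some hull dart `x`
(the cone of the fan triangle between `x` and `σ_H x`). -/
theorem exists_mem_dartCone (hX1 : ∀ y ∈ X, ‖y‖ = 1)
    (h0 : (0 : EuclideanSpace ℝ (Fin 3)) ∈ interior (convexHull ℝ (X : Set _)))
    (z : EuclideanSpace ℝ (Fin 3)) : ∃ x : ↥(hullDarts X), z ∈ dartCone X x := by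
  classical
  -- the facet whose cone contains `z`
  obtain ⟨c, hc, hz⟩ := exists_mem_argmaxCone (facetNormals X) (facetNormals_nonempty h0) z
  rw [argmaxCone_facetNormals_eq h0 hc] at hz
  obtain ⟨t, ht, p, hp, rfl⟩ := hz
  have hc0 : c ≠ 0 := ne_zero_of_mem_facetNormals hX1 hc
  set m := (tightSet X c).card with hmdef
  have hm3 : 3 ≤ m := three_le_card_tightSet hc
  -- `p` as a convex combination of the facet vertices `fVert X c 0, …, fVert X c (m-1)`
  obtain ⟨μ, hμ0, hμ1, hpeq⟩ := Finset.mem_convexHull'.1 hp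
  set w : ℕ → EuclideanSpace ℝ (Fin 3) := fVert X c with hw
  have hwinj : Set.InjOn w (range m) := by
    intro i hi j hj hij
    by_contra hne
    exact fVert_ne_of_ne hX1 hc (mem_range.1 (Finset.mem_coe.1 hi))
      (mem_range.1 (Finset.mem_coe.1 hj)) hne hij
  have himage : (range m).image w = tightSet X c := by
    rw [hw, hmdef, ← card_facetAngles hX1 hc0]
    have : (range (facetAngles X c hc0).card).image (fVert X c) =
        (range (facetAngles X c hc0).card).image (facetVertex X c hc0) :=
      Finset.image_congr fun i _ => fVert_eq hc0 i
    rw [this, image_range_facetVertex hX1 hc0]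
  have hpsum : p = ∑ i ∈ range m, μ (w i) • w i := by
    rw [← hpeq, ← himage, Finset.sum_image hwinj]
  -- the fan triangle containing `z = t • p`
  have hcoef : ∀ i, 0 ≤ (fun i => if i < m then t * μ (w i) else 0) i := by
    intro i
    show 0 ≤ (if i < m then t * μ (w i) else 0)
    by_cases hi : i < m
    · rw [if_pos hi]
      exact mul_nonneg ht (hμ0 _ (by rw [← himage]; exact mem_image_of_mem _ (mem_range.2 hi)))
    · rw [if_neg hi]
  have hzsum : t • p = ∑ i ∈ range m, (fun i => if i < m then t * μ (w i) else 0) i • w i := by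
    rw [hpsum, Finset.smul_sum]
    refine Finset.sum_congr rfl fun i hi => ?_
    rw [mem_range] at hi
    show t • (μ (w i) • w i) = (if i < m then t * μ (w i) else 0) • w i
    rw [if_pos hi, smul_smul]
  obtain ⟨k, hk1, hkm, a, b, d, ha, hb, hd, hzeq⟩ :=
    exists_mem_cone_fan_of_combination hm3 w
      (fun i j k hij hjk hk => orient3_fVert_pos hX1 hc hij hjk hk) _ hcoef hzsum
  -- it is the left triangle of the dart `(w 0, w k)`
  have hT : ({w 0, w k, w (k + 1)} : Finset (EuclideanSpace ℝ (Fin 3))) ∈ fanTriSets X := by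
    rw [mem_fanTriSets]
    refine ⟨(c, k - 1), mem_fanTriangles.2 ⟨hc, by rw [← hmdef]; omega⟩, ?_⟩
    unfold fanVerts
    rw [show k - 1 + 1 = k by omega, show k - 1 + 2 = k + 1 by omega]
  have h0k : w 0 ≠ w k := fVert_ne_of_ne hX1 hc (by omega) (by omega) (by omega)
  have hdart : (w 0, w k) ∈ hullDarts X := mk_mem_hullDarts hT (by simp) (by simp) h0k
  have hsucc : succV X (w 0) (w k) = w (k + 1) :=
    (succV_eq_iff hX1 h0 hdart).2 ⟨hT, orient3_fVert_pos hX1 hc (by omega : 0 < k)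
      (Nat.lt_succ_self k) (by omega)⟩
  exact ⟨⟨(w 0, w k), hdart⟩, a, b, d, ha, hb, hd, by rw [hsucc]; exact hzeq⟩

/-! ## Every hull dart lies in a corner of a covering sub-map -/

/-- **Corner localisation.** If `S` covers every vertex, every hull dart `x` lies in the corner
of some dart `w ∈ S` at its tail: `σ_H^i w = x` with `i < retTime S w`. -/
theorem exists_corner_of_cover {S : Finset ↥(hullDarts X)}
    (hcov : ∀ y ∈ X, ∃ w ∈ S, w.1.1 = y) (x : ↥(hullDarts X)) :
    ∃ w ∈ S, ∃ i, i < RotSys.retTime (rot hX1 h0) S w ∧ (rot hX1 h0 ^ i) w = x := by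
  classical
  obtain ⟨w₀, hw₀, hw₀x⟩ := hcov x.1.1 (fst_mem_of_mem_hullDarts hX1 x.2)
  have hcyc : (rot hX1 h0).SameCycle w₀ x := (sameCycle_rot_iff w₀ x).2 hw₀x
  obtain ⟨n, -, hn⟩ := hcyc.exists_pow_eq'
  -- the last `j ≤ n` with `σ^j w₀ ∈ S`
  set j := Nat.findGreatest (fun j => (rot hX1 h0 ^ j) w₀ ∈ S) n with hj
  have hjS : (rot hX1 h0 ^ j) w₀ ∈ S :=
    Nat.findGreatest_spec (P := fun j => (rot hX1 h0 ^ j) w₀ ∈ S) (Nat.zero_le n)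
      (by rw [pow_zero, Perm.one_apply]; exact hw₀)
  have hjn : j ≤ n := Nat.findGreatest_le n
  refine ⟨(rot hX1 h0 ^ j) w₀, hjS, n - j, ?_, ?_⟩
  · by_contra hle
    push Not at hle
    obtain ⟨hr0, hrS⟩ := RotSys.retTime_spec (rot hX1 h0) hjS
    set r := RotSys.retTime (rot hX1 h0) S ((rot hX1 h0 ^ j) w₀) with hr
    have hmem : (rot hX1 h0 ^ (j + r)) w₀ ∈ S := by
      rw [add_comm, pow_add, Perm.mul_apply]; exact hrS
    have := Nat.findGreatest_is_greatest (P := fun j => (rot hX1 h0 ^ j) w₀ ∈ S)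
      (show j < j + r by omega) (by omega)
    exact this hmem
  · rw [← Perm.mul_apply, ← pow_add, Nat.sub_add_cancel hjn, hn]

/-- **Every vector lies in the corner fan of some face** of a covering `α`-closed sub-map. -/
theorem exists_inCornerFan_of_cover {S : Finset ↥(hullDarts X)} (hS : RotSys.IsClosed (inv X) S)
    (hcov : ∀ y ∈ X, ∃ w ∈ S, w.1.1 = y) (z : EuclideanSpace ℝ (Fin 3)) :
    ∃ d ∈ S, InCornerFan hX1 h0 S d z := by
  obtain ⟨x, hx⟩ := exists_mem_dartCone hX1 h0 z
  obtain ⟨w, hw, i, hi, hwx⟩ := exists_corner_of_cover (hX1 := hX1) (h0 := h0) hcov x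
  have hrs : RotSys.IsRotSys (rot hX1 h0) (inv X) := isRotSys
  refine ⟨inv X w, hS _ hw, 0, i, ?_, ?_⟩
  · rw [faceDart_zero, hrs.α_inv]; exact hi
  · rw [faceDart_zero, hrs.α_inv, hwx]; exact hx

end HullRotSys

end Summit.Ventures.Crystal3D
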